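import Summits.KontsevichZagierPeriods.KontsevichZagierPeriods.Theorems.HurwitzMicroSectorsNormalFormPrincipleBoxUnicoordRigidity
import Summits.KontsevichZagierPeriods.KontsevichZagierPeriods.Theorems.HurwitzMicroSectorsNormalFormPrincipleSplitMoves
import Summits.KontsevichZagierPeriods.KontsevichZagierPeriods.Theorems.HurwitzMicroSectorsNormalFormPrincipleLevelOneExistsRep
import Summits.KontsevichZagierPeriods.KontsevichZagierPeriods.Theorems.HurwitzMicroSectorsNormalFormPrincipleLevelOneValueZetaTwoRep
import Summits.KontsevichZagierPeriods.KontsevichZagierPeriods.Theorems.HurwitzMicroSectorsNormalFormPrincipleLevelOneBoxPolyExistsPt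
import Summits.KontsevichZagierPeriods.KontsevichZagierPeriods.Theorems.HurwitzMicroSectorsNormalFormPrincipleLevelOneExistsTriangleRep
import Summits.KontsevichZagierPeriods.KontsevichZagierPeriods.Theorems.HurwitzMicroSectorsNormalFormPrincipleLevelOneMergeBoxSubTriangle
import Summits.KontsevichZagierPeriods.KontsevichZagierPeriods.Theorems.HurwitzMicroSectorsNormalFormPrincipleLevelOneTriangleSubDimOne
import Literature.NumberTheory.Transcendental.BoxIntegralZetaValues
import Literature.NumberTheory.Transcendental.KZLogCalculusProofs
import Literature.NumberTheory.Transcendental.KZProductIdeal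

/-!
# `NormalFormPrinciple` (stmt-KontsevichZagierPeriods-3869), line `SketchIdeator1` — the leaf
# `stub_boxRigidity` in DIMENSION TWO, level one, I: the REDUCTION of `[(0,1)², P(x,y)/(1 − xy)]`

Pure proof file (lead seat c7; `--supports` the crux; registered sub-goal `levelOne_reduce`; the
rigidity half is the companion file `…LevelOne.lean`). The registered leaf `stub_boxRigidity` (Conjecture 1 of
Kontsevich–Zagier frozen to box-rational representations) is a theorem in dimension `≤ 1`
(`…BoxRigidityDimOne`, `…DimOneAssembly`) and on the unicoordinate family (`…BoxUnicoordRigidity`).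
This file opens DIMENSION TWO with Kontsevich–Zagier's own showcase family: all representations
`[(0,1)², P(x₀,x₁)/(1 − x₀x₁)]`, `P ∈ ℚ[x₀,x₁]`, whose values fill `ℚ + ℚζ(2)`
(`∫∫ x₀^a x₁^b/(1 − x₀x₁) = Σₙ 1/((n+a+1)(n+b+1))`). UNCONDITIONALLY:

* `levelOne_reduce` — every such representation is congruent modulo KZ relations to the normal form
  `[(0,1)², β/(1 − x₀x₁)] + [pt, q]`, `β, q ∈ ℚ`. Engine (card `merge-gadget-join-rung` of the crux):
  an OFF-DIAGONAL monomial `c x₀^a x₁^b`, `a > b`, is sent by the merge gadget `(x₀,x₁) ↦ (x₀, x₀x₁)`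
  (rule 2, the affine substitution along the last coordinate; `merge_box_sub_triangle`) onto the
  triangle `{0 < z₀ < 1, 0 ≤ z₁ ≤ z₀}` with integrand `c z₀^{a−b−1} z₁^b/(1 − z₁)`, where one
  Newton–Leibniz move along `z₀` (rule 3; `triangle_sub_dimOne`) leaves the POLYNOMIAL
  `(c/(a−b)) s^b Σ_{i<a−b} s^i` on `(0,1)`, which collapses to a rational point (`boxPoly_exists_pt`,
  the Unicoord engine); `a < b` by the symmetry `x₀ ↔ x₁` (rule 2); a DIAGONAL monomial is
  `c/(1 − x₀x₁)` minus a polynomial (rule 1b, geometric sum); sums by integrand additivity;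
* `levelOne_value` — the value is `β·π²/6 + q` (`∫∫ dx₀dx₁/(1 − x₀x₁) = ζ(2) = π²/6`, Beukers);
* `boxRigidity_levelOne_dim_two` — **Conjecture 1 on the family**: equal values ⇒ KZ-equivalent,
  because `π² ∉ ℚ` (`CalegariDimitrovTang.irrational_pi_sq`, Lindemann) compares the coefficients
  (`levelOne_rigid_numbers`) and two representations with a common normal form are equivalent;
* `mem_relations_of_eval_eq_zero_of_mem_closure` — the kernel form on the subgroup generated by the
  family and all polynomial boxes `[(0,1)ᵐ, p]` (`KZ.PiLocalKernel` with exponent `0` there);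
* `levelOne_equivalent_boxPoly_of_value_eq` — the mixed pairs: a level-one box against a polynomial
  box of any dimension (in particular a rational point);
* `boxRigidity_levelOne` — the same in the `IsRational` vocabulary of the leaf.

The seven registered sub-goals of the wave live in the files `…LevelOneExistsRep`,
`…LevelOneExistsTriangleRep`, `…LevelOneMergeBoxSubTriangle`, `…LevelOneTriangleSubDimOne`,
`…LevelOneBoxPolyExistsPt`, `…LevelOneRigidNumbers`, `…LevelOneValueZetaTwoRep`.
Sources: M. Kontsevich, D. Zagier, *Periods* (2001), §1.1 (the example `ζ(2)`), §1.2 Conjecture 1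
and rules (1)–(3); F. Beukers, *A note on the irrationality of ζ(2) and ζ(3)*, Bull. LMS 11 (1979).
No definitions are introduced.
-/

noncomputable section

open MeasureTheory Set
open scoped Polynomial
open Literature.NumberTheory.Transcendental Literature.NumberTheory.Transcendental.KZ
open Literature.ModelTheory.ExponentialFields (IsSemialgebraic)

namespace Summit.KontsevichZagierPeriods.HurwitzMicroSectors.NormalFormPrinciple.PiBox.LevelOne

open Summit.KontsevichZagierPeriods.HurwitzMicroSectors.NormalFormPrinciple.PiBox.Dlog
  (exists_ptCarrier value_pt pt_add_mem_relations pt_zero_mem_relations pt_congr_mem_relations)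

/-! ## Composition (lead) -/

/-! ### Box representations with polynomial integrands exist -/

/-- **The polynomial box representation `[(0,1)ᵐ, p]` exists** (restriction of the tame cube
`[[0,1]ᵐ, p]` of `KZ.RFun.poly` to the open box). [cite: KontsevichZagier2001, §1.1] -/
theorem exists_boxPolyRep {m : ℕ} (p : MvPolynomial (Fin m) ℚ) :
    ∃ N : IntegralRep m, N.domain = {x | ∀ i, x i ∈ Set.Ioo (0:ℝ) 1} ∧
      EqOn N.integrand (fun x => (MvPolynomial.aeval x p : ℝ)) N.domain := by
  have hsub : {x : Fin m → ℝ | ∀ i, x i ∈ Set.Ioo (0:ℝ) 1} ⊆ (RFun.poly p).rep.domain := by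
    rw [RFun.rep_domain]
    exact Unicoord.box_subset_cube m
  refine ⟨(RFun.poly p).rep.restrict _ (isSemialgebraic_box m) hsub, rfl, fun x _ => ?_⟩
  show (RFun.poly p).fn x = _
  rw [RFun.fn_poly]

/-! ### Monomials of `P`: evaluation -/

/-- Evaluation of a monomial of `ℚ[x₀, x₁]` at a real point. [folklore] -/
theorem aeval_monomial_two (s : Fin 2 →₀ ℕ) (c : ℚ) (x : Fin 2 → ℝ) :
    (MvPolynomial.aeval x (MvPolynomial.monomial s c) : ℝ) = (c : ℝ) * (x 0 ^ (s 0) * x 1 ^ (s 1)) := by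
  rw [MvPolynomial.aeval_monomial, Finsupp.prod_fintype _ _ (fun i => by simp), Fin.prod_univ_two]
  simp

/-! ### The symmetry `x₀ ↔ x₁` of the family -/

/-- **Coordinate swap** (rule 2): `[(0,1)², c x₀^a x₁^b/(1 − x₀x₁)] ≡ [(0,1)², c x₀^b x₁^a/(1 − x₀x₁)]`.
[cite: KontsevichZagier2001, §1.2 rule (2)] -/
theorem swap_monomial_sub_mem_relations (a b : ℕ) (c : ℚ) (N N' : IntegralRep 2)
    (hNd : N.domain = {x | ∀ i, x i ∈ Set.Ioo (0:ℝ) 1})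
    (hNi : EqOn N.integrand (fun x => (c : ℝ) * (x 0 ^ a * x 1 ^ b) / (1 - x 0 * x 1)) N.domain)
    (hN'd : N'.domain = {x | ∀ i, x i ∈ Set.Ioo (0:ℝ) 1})
    (hN'i : EqOn N'.integrand (fun x => (c : ℝ) * (x 0 ^ b * x 1 ^ a) / (1 - x 0 * x 1)) N'.domain) :
    of N - of N' ∈ relations := by
  have h1 := of_sub_of_reindex_mem_relations N (Equiv.swap (0 : Fin 2) 1)
  have hd : (N.reindex (Equiv.swap (0 : Fin 2) 1)).domain = {x | ∀ i, x i ∈ Set.Ioo (0:ℝ) 1} := by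
    ext w
    simp only [IntegralRep.reindex_domain, hNd, mem_setOf_eq, Fin.forall_fin_two,
      Equiv.swap_apply_left, Equiv.swap_apply_right]
    tauto
  have h2 : of (N.reindex (Equiv.swap (0 : Fin 2) 1)) - of N' ∈ relations := by
    refine of_sub_of_mem_relations_of_eqOn (hN'd.trans hd.symm) fun w hw => ?_
    have hw' : (fun i => w (Equiv.swap (0 : Fin 2) 1 i)) ∈ N.domain := by
      rw [IntegralRep.reindex_domain] at hw
      exact hw
    rw [IntegralRep.reindex_integrand]
    show N.integrand (fun i => w (Equiv.swap (0 : Fin 2) 1 i)) = N'.integrand w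
    rw [hNi hw', hN'i (hN'd ▸ hd ▸ hw)]
    simp only [Equiv.swap_apply_left, Equiv.swap_apply_right]
    ring
  have e : of N - of N' = (of N - of (N.reindex (Equiv.swap (0 : Fin 2) 1))) +
      (of (N.reindex (Equiv.swap (0 : Fin 2) 1)) - of N') := by abel
  rw [e]
  exact relations.add_mem h1 h2

/-! ### Off-diagonal monomials collapse to rational points -/

/-- The polynomial `(c/(a−b))·X₀^b·Σ_{i<a−b} X₀^i ∈ ℚ[x₀]` produced by the merge gadget. [folklore] -/
theorem aeval_mergePoly (a b : ℕ) (c : ℚ) (x : Fin 1 → ℝ) :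
    (MvPolynomial.aeval x (MvPolynomial.C (c / ((a - b : ℕ) : ℚ)) * (MvPolynomial.X 0 ^ b *
      ∑ i ∈ Finset.range (a - b), MvPolynomial.X 0 ^ i) : MvPolynomial (Fin 1) ℚ) : ℝ) =
      (c : ℝ) / ((a - b : ℕ) : ℝ) * (x 0 ^ b * ∑ i ∈ Finset.range (a - b), x 0 ^ i) := by
  simp [map_sum, map_mul, map_pow]

/-- **An off-diagonal monomial with `a > b` collapses to a rational point**: merge gadget
(`merge_box_sub_triangle`), Newton–Leibniz (`triangle_sub_dimOne`), and the polynomial collapse in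
dimension one (`boxPoly_exists_pt`). [cite: KontsevichZagier2001, §1.2] -/
theorem offDiag_exists_pt_of_lt (a b : ℕ) (c : ℚ) (hab : b < a) (N : IntegralRep 2)
    (hNd : N.domain = {x | ∀ i, x i ∈ Set.Ioo (0:ℝ) 1})
    (hNi : EqOn N.integrand (fun x => (c : ℝ) * (x 0 ^ a * x 1 ^ b) / (1 - x 0 * x 1)) N.domain) :
    ∃ q : ℚ, ∀ Z : IntegralRep 0, Z.domain = Set.univ → (Z.integrand = fun _ => (q : ℝ)) →
      of N - of Z ∈ relations := by
  obtain ⟨R, hRd, hRi⟩ := exists_triangleRep a b c hab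
  have h1 := merge_box_sub_triangle a b c hab N R hNd hNi hRd (by rw [hRi]; exact fun _ _ => rfl)
  set p₁ : MvPolynomial (Fin 1) ℚ := MvPolynomial.C (c / ((a - b : ℕ) : ℚ)) *
    (MvPolynomial.X 0 ^ b * ∑ i ∈ Finset.range (a - b), MvPolynomial.X 0 ^ i) with hp₁
  obtain ⟨N₁, hN₁d, hN₁i⟩ := exists_boxPolyRep p₁
  have h2 := triangle_sub_dimOne a b c hab R N₁ hRd (by rw [hRi]; exact fun _ _ => rfl) hN₁d
    (fun x hx => by
      rw [hN₁i hx]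
      show (MvPolynomial.aeval x p₁ : ℝ) = _
      rw [hp₁]
      exact aeval_mergePoly a b c x)
  obtain ⟨q, hq⟩ := boxPoly_exists_pt p₁ N₁ hN₁d hN₁i
  refine ⟨q, fun Z hZd hZi => ?_⟩
  have e : of N - of Z = (of N - of R) + (of R - of N₁) + (of N₁ - of Z) := by abel
  rw [e]
  exact relations.add_mem (relations.add_mem h1 h2) (hq Z hZd hZi)

/-- **Every off-diagonal monomial collapses to a rational point** (`a < b` by the symmetry first).
[cite: KontsevichZagier2001, §1.2] -/
theorem offDiag_exists_pt (a b : ℕ) (c : ℚ) (hab : a ≠ b) (N : IntegralRep 2)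
    (hNd : N.domain = {x | ∀ i, x i ∈ Set.Ioo (0:ℝ) 1})
    (hNi : EqOn N.integrand (fun x => (c : ℝ) * (x 0 ^ a * x 1 ^ b) / (1 - x 0 * x 1)) N.domain) :
    ∃ q : ℚ, ∀ Z : IntegralRep 0, Z.domain = Set.univ → (Z.integrand = fun _ => (q : ℝ)) →
      of N - of Z ∈ relations := by
  rcases lt_or_gt_of_ne hab with h | h
  · -- `a < b`: swap the coordinates first
    let s : Fin 2 →₀ ℕ := Finsupp.single 0 b + Finsupp.single 1 a
    obtain ⟨N', hN'd, hN'i⟩ := exists_levelOneRep (MvPolynomial.monomial s c)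
    have hN'i' : EqOn N'.integrand (fun x => (c : ℝ) * (x 0 ^ b * x 1 ^ a) / (1 - x 0 * x 1))
        N'.domain := fun x _ => by
      rw [hN'i]
      show (MvPolynomial.aeval x (MvPolynomial.monomial s c) : ℝ) / (1 - x 0 * x 1) = _
      rw [aeval_monomial_two]
      simp [s]
    have h1 := swap_monomial_sub_mem_relations a b c N N' hNd hNi hN'd hN'i'
    obtain ⟨q, hq⟩ := offDiag_exists_pt_of_lt b a c h N' hN'd hN'i'
    refine ⟨q, fun Z hZd hZi => ?_⟩
    have e : of N - of Z = (of N - of N') + (of N' - of Z) := by abel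
    rw [e]
    exact relations.add_mem h1 (hq Z hZd hZi)
  · exact offDiag_exists_pt_of_lt a b c h N hNd hNi

/-! ### Diagonal monomials: `c t^a/(1 − t) = c/(1 − t) − c Σ_{i<a} t^i` -/

/-- The geometric-sum identity behind the diagonal reduction. [folklore] -/
theorem diag_identity (c t : ℝ) (a : ℕ) (ht : 1 - t ≠ 0) :
    c * t ^ a / (1 - t) = c / (1 - t) + -(c * ∑ i ∈ Finset.range a, t ^ i) := by
  have h := mul_neg_geom_sum t a
  field_simp
  linear_combination c * h

/-- **A diagonal monomial is `c/(1 − x₀x₁)` plus a polynomial, hence `[(0,1)², c/(1−x₀x₁)] + [pt, q]`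
modulo relations** (integrand additivity, then `boxPoly_exists_pt`). [cite: KontsevichZagier2001, §1.2] -/
theorem diag_exists_pt (a : ℕ) (c : ℚ) (N : IntegralRep 2)
    (hNd : N.domain = {x | ∀ i, x i ∈ Set.Ioo (0:ℝ) 1})
    (hNi : EqOn N.integrand (fun x => (c : ℝ) * (x 0 ^ a * x 1 ^ a) / (1 - x 0 * x 1)) N.domain) :
    ∃ q : ℚ, ∀ (B : IntegralRep 2) (Z : IntegralRep 0),
      B.domain = {x | ∀ i, x i ∈ Set.Ioo (0:ℝ) 1} →
      EqOn B.integrand (fun x => (c : ℝ) / (1 - x 0 * x 1)) B.domain →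
      Z.domain = Set.univ → (Z.integrand = fun _ => (q : ℝ)) →
      of N - of B - of Z ∈ relations := by
  -- the polynomial part `−c Σ_{i<a} (x₀x₁)^i`
  set pQ : MvPolynomial (Fin 2) ℚ :=
    -(MvPolynomial.C c * ∑ i ∈ Finset.range a, (MvPolynomial.X 0 * MvPolynomial.X 1) ^ i) with hpQ
  obtain ⟨Q, hQd, hQi⟩ := exists_boxPolyRep pQ
  obtain ⟨q, hq⟩ := boxPoly_exists_pt pQ Q hQd hQi
  refine ⟨q, fun B Z hBd hBi hZd hZi => ?_⟩
  have hadd : of N - of B - of Q ∈ relations := by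
    refine integrandAddRel_subset_relations ⟨2, N, B, Q, hBd.trans hNd.symm, hQd.trans hNd.symm,
      fun x hx => ?_, rfl⟩
    have hxB : x ∈ B.domain := by rw [hBd, ← hNd]; exact hx
    have hxQ : x ∈ Q.domain := by rw [hQd, ← hNd]; exact hx
    rw [Pi.add_apply, hNi hx, hBi hxB, hQi hxQ, hpQ]
    have hx' : ∀ i, x i ∈ Set.Ioo (0:ℝ) 1 := by rw [hNd] at hx; exact hx
    have ht : 1 - x 0 * x 1 ≠ 0 := (one_sub_mul_pos_of_mem_box hx').ne'
    simp only [map_neg, map_mul, MvPolynomial.aeval_C, map_sum, map_pow, MvPolynomial.aeval_X,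
      eq_ratCast]
    rw [← mul_pow]
    exact diag_identity c (x 0 * x 1) a ht
  have e : of N - of B - of Z = (of N - of B - of Q) + (of Q - of Z) := by abel
  rw [e]
  exact relations.add_mem hadd (hq Z hZd hZi)

/-! ### Additivity of the normal form pieces -/

/-- The box part of the normal form exists for every `β`. [cite: KontsevichZagier2001, §1.1] -/
theorem exists_zetaTwoRep (β : ℚ) :
    ∃ B : IntegralRep 2, B.domain = {x | ∀ i, x i ∈ Set.Ioo (0:ℝ) 1} ∧
      EqOn B.integrand (fun x => (β : ℝ) / (1 - x 0 * x 1)) B.domain := by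
  obtain ⟨B, hBd, hBi⟩ := exists_levelOneRep (MvPolynomial.C β)
  exact ⟨B, hBd, fun x _ => by rw [hBi]; simp⟩

/-- Additivity of the box part in `β` (rule 1b). [cite: KontsevichZagier2001, §1.2 rule (1)] -/
theorem zetaTwoRep_add_mem_relations {β₁ β₂ : ℚ} (B B₁ B₂ : IntegralRep 2)
    (hBd : B.domain = {x | ∀ i, x i ∈ Set.Ioo (0:ℝ) 1})
    (hBi : EqOn B.integrand (fun x => ((β₁ + β₂ : ℚ) : ℝ) / (1 - x 0 * x 1)) B.domain)
    (hB₁d : B₁.domain = {x | ∀ i, x i ∈ Set.Ioo (0:ℝ) 1})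
    (hB₁i : EqOn B₁.integrand (fun x => (β₁ : ℝ) / (1 - x 0 * x 1)) B₁.domain)
    (hB₂d : B₂.domain = {x | ∀ i, x i ∈ Set.Ioo (0:ℝ) 1})
    (hB₂i : EqOn B₂.integrand (fun x => (β₂ : ℝ) / (1 - x 0 * x 1)) B₂.domain) :
    of B - of B₁ - of B₂ ∈ relations := by
  refine integrandAddRel_subset_relations ⟨2, B, B₁, B₂, hB₁d.trans hBd.symm, hB₂d.trans hBd.symm,
    fun x hx => ?_, rfl⟩
  have hx₁ : x ∈ B₁.domain := by rw [hB₁d, ← hBd]; exact hx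
  have hx₂ : x ∈ B₂.domain := by rw [hB₂d, ← hBd]; exact hx
  rw [Pi.add_apply, hBi hx, hB₁i hx₁, hB₂i hx₂]
  push_cast
  ring

/-- Congruence of box parts with the same `β`. [cite: KontsevichZagier2001, §1.2 rule (1)] -/
theorem zetaTwoRep_congr_mem_relations {β : ℚ} (B B' : IntegralRep 2)
    (hBd : B.domain = {x | ∀ i, x i ∈ Set.Ioo (0:ℝ) 1})
    (hBi : EqOn B.integrand (fun x => (β : ℝ) / (1 - x 0 * x 1)) B.domain)
    (hB'd : B'.domain = {x | ∀ i, x i ∈ Set.Ioo (0:ℝ) 1})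
    (hB'i : EqOn B'.integrand (fun x => (β : ℝ) / (1 - x 0 * x 1)) B'.domain) :
    of B - of B' ∈ relations :=
  of_sub_of_mem_relations_of_eqOn (hB'd.trans hBd.symm) fun x hx => by
    rw [hBi hx, hB'i (by rw [hB'd, ← hBd]; exact hx)]

/-- The box part with `β = 0` is a relation. [cite: KontsevichZagier2001, §1.2 rule (1)] -/
theorem zetaTwoRep_zero_mem_relations (B : IntegralRep 2)
    (hBi : EqOn B.integrand (fun x => ((0 : ℚ) : ℝ) / (1 - x 0 * x 1)) B.domain) :
    of B ∈ relations :=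
  of_mem_relations_of_eqOn_zero B fun x hx => by rw [hBi hx]; simp

/-! ### The reduction -/

/-- **Reduction to the normal form** `[(0,1)², β/(1 − x₀x₁)] + [pt, q]`, `β, q ∈ ℚ`: every
representation `[(0,1)², P(x₀,x₁)/(1 − x₀x₁)]` (`P ∈ ℚ[x₀,x₁]`) differs from it by Kontsevich–Zagier
relations. Induction on `P`: monomials by `diag_exists_pt` / `offDiag_exists_pt`, sums by integrand
additivity. [cite: KontsevichZagier2001, §1.2] -/
theorem levelOne_reduce (P : MvPolynomial (Fin 2) ℚ) :
    ∀ (N : IntegralRep 2), N.domain = {x | ∀ i, x i ∈ Set.Ioo (0:ℝ) 1} →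
      EqOn N.integrand (fun x => (MvPolynomial.aeval x P : ℝ) / (1 - x 0 * x 1)) N.domain →
      ∃ β q : ℚ, ∀ (B : IntegralRep 2) (Z : IntegralRep 0),
        B.domain = {x | ∀ i, x i ∈ Set.Ioo (0:ℝ) 1} →
        EqOn B.integrand (fun x => (β : ℝ) / (1 - x 0 * x 1)) B.domain →
        Z.domain = Set.univ → (Z.integrand = fun _ => (q : ℝ)) →
        of N - of B - of Z ∈ relations := by
  induction P using MvPolynomial.induction_on' with
  | monomial s c =>
    intro N hNd hNi
    have hNi' : EqOn N.integrand (fun x => (c : ℝ) * (x 0 ^ (s 0) * x 1 ^ (s 1)) / (1 - x 0 * x 1))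
        N.domain := fun x hx => by rw [hNi hx]; simp only [aeval_monomial_two]
    by_cases hs : s 0 = s 1
    · rw [hs] at hNi'
      obtain ⟨q, hq⟩ := diag_exists_pt (s 1) c N hNd hNi'
      exact ⟨c, q, hq⟩
    · obtain ⟨q, hq⟩ := offDiag_exists_pt (s 0) (s 1) c hs N hNd hNi'
      refine ⟨0, q, fun B Z hBd hBi hZd hZi => ?_⟩
      have e : of N - of B - of Z = (of N - of Z) - of B := by abel
      rw [e]
      exact relations.sub_mem (hq Z hZd hZi) (zetaTwoRep_zero_mem_relations B hBi)
  | add P Q ihP ihQ =>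
    intro N hNd hNi
    obtain ⟨NP, hNPd, hNPi⟩ := exists_levelOneRep P
    obtain ⟨NQ, hNQd, hNQi⟩ := exists_levelOneRep Q
    obtain ⟨β₁, q₁, h₁⟩ := ihP NP hNPd (by rw [hNPi]; exact fun _ _ => rfl)
    obtain ⟨β₂, q₂, h₂⟩ := ihQ NQ hNQd (by rw [hNQi]; exact fun _ _ => rfl)
    refine ⟨β₁ + β₂, q₁ + q₂, fun B Z hBd hBi hZd hZi => ?_⟩
    -- split `N` along `P + Q`
    have hsplit : of N - of NP - of NQ ∈ relations := by
      refine integrandAddRel_subset_relations ⟨2, N, NP, NQ, hNPd.trans hNd.symm,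
        hNQd.trans hNd.symm, fun x hx => ?_, rfl⟩
      rw [Pi.add_apply, hNi hx, hNPi, hNQi]
      simp only [map_add]
      ring
    -- normal forms of the two halves
    obtain ⟨B₁, hB₁d, hB₁i⟩ := exists_zetaTwoRep β₁
    obtain ⟨B₂, hB₂d, hB₂i⟩ := exists_zetaTwoRep β₂
    obtain ⟨Zf, hZf⟩ := exists_ptCarrier
    have e₁ := h₁ B₁ (Zf q₁) hB₁d hB₁i (hZf q₁).1 (hZf q₁).2
    have e₂ := h₂ B₂ (Zf q₂) hB₂d hB₂i (hZf q₂).1 (hZf q₂).2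
    have eB := zetaTwoRep_add_mem_relations B B₁ B₂ hBd hBi hB₁d hB₁i hB₂d hB₂i
    have eZ := pt_add_mem_relations Z (Zf q₁) (Zf q₂) hZd (hZf q₁).1 (hZf q₂).1
      (by rw [hZi]; push_cast; rfl) (hZf q₁).2 (hZf q₂).2
    have e : of N - of B - of Z = (of N - of NP - of NQ) + (of NP - of B₁ - of (Zf q₁)) +
        (of NQ - of B₂ - of (Zf q₂)) - (of B - of B₁ - of B₂) - (of Z - of (Zf q₁) - of (Zf q₂)) := by
      abel
    rw [e]
    exact relations.sub_mem (relations.sub_mem (relations.add_mem (relations.add_mem hsplit e₁) e₂)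
      eB) eZ

/-- **Values on the family**: with `β, q` from `levelOne_reduce`, `N.value = β·π²/6 + q`
(soundness of the calculus, `value_zetaTwoRep`, `value_pt`). [cite: KontsevichZagier2001, §1.1] -/
theorem levelOne_value {N : IntegralRep 2} {β q : ℚ}
    (h : ∀ (B : IntegralRep 2) (Z : IntegralRep 0),
        B.domain = {x | ∀ i, x i ∈ Set.Ioo (0:ℝ) 1} →
        EqOn B.integrand (fun x => (β : ℝ) / (1 - x 0 * x 1)) B.domain →
        Z.domain = Set.univ → (Z.integrand = fun _ => (q : ℝ)) →
        of N - of B - of Z ∈ relations) :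
    N.value = (β : ℝ) * (Real.pi ^ 2 / 6) + q := by
  obtain ⟨B, hBd, hBi⟩ := exists_zetaTwoRep β
  obtain ⟨Zf, hZf⟩ := exists_ptCarrier
  have h0 := relations_le_ker_eval_holds (h B (Zf q) hBd hBi (hZf q).1 (hZf q).2)
  rw [AddMonoidHom.mem_ker, map_sub, map_sub, eval_of, eval_of, eval_of,
    value_zetaTwoRep β B hBd hBi, value_pt (Zf q) (hZf q).1 (hZf q).2] at h0
  linarith

end Summit.KontsevichZagierPeriods.HurwitzMicroSectors.NormalFormPrinciple.PiBox.LevelOne
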